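/-
Origin: expansion seat `prover-pub-hodgecm-mc-discharge-1-g16-0`, handover #7 r2 2026-08-19T18:06Z (r1 18:03Z cb00cee0658e 196 l. + § 4) md5 7edd189acd62ee0c54a78b2bfc4f3b16 (227 l.) NEW additive PKG leaf — ticket D-6, the ABSTRACT K-TYPE HEART of `Real34GenMem`'s hypothesis `hdec` (PerL L3.5 (34), tex ll. 367–372 «∧² of 𝔭₊ is det; Sym² has no det»): ns `HodgeCM.Model.KTypeWedge`; `biS τ e f w := Σ w a b • τ (e a) (f b)` (pairing of two 𝔭₊-frames along a coefficient tensor, ANY bilinear `τ : S₂ →ₗ S₃ →ₗ S_W` into a bare ℂ-module — no topology on S_W), `biS_sub_tr`, `avg_eq_zero_of_tr_eq` (Haar-averaged symmetric tensor = 0 given diag(s,t) s≠t + an antidiagonal in the image of ρ), `T_eq_det_smul_of_tr_eq_neg`, § 4 `eq_zero_of_weights` (the U(1)-weight count: a vector on which a central element acts by `c ξ^{n₂} ξ^{n₃}` and by `c ξ²`, ξ ≠ 0 of infinite order, nⱼ ≥ 1, (n₂,n₃) ≠ (1,1), is 0), MAIN `biS_eq_smul_wedge_of_detType (μ) (hρc)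 (hρ) (h₁) (h₂) (τ e f ωW c) (hc) (hS : ωW k (biS w) = c k • biS (T (ρ k) w)) (m) (hv : ωW k (biS m) = (c k * det ρ k) • biS m) : biS τ e f m = ((m 0 1 − m 1 0)/2) • (τ (e 0) (f 1) − τ (e 1) (f 0))` — proof: antisym/sym split, the sym part is det-type, tested against every `Module.Dual` functional and Haar-averaged in the coefficient space ℂ²⊗ℂ² (`Qaut.avg`, `ContinuousLinearMap.integral_comp_comm`, `Module.forall_dual_apply_eq_zero_iff`). Imports ONLY PKG `HodgeCM/PerL34/QautWedge` (RUN 22): world-independent, installs anywhere (RUN 36 or 37). CERT: plain `lean -o` against RUN-35 PKG oleans rc 0 / 0 warnings; `#print axioms` 5/5 trio (`d6/logs3/AxiomsKTW.log`, probe `d6/probe/AxiomsKTW.lean`). KERNEL, 0 records, 0 `def … : Prop`, 0 proof-hole, nothing cited, MODEL-N ±0, E text untouched. (`HOME/mc/pub-hodgecm-mc-discharge-1/d6/HodgeCM/Model/Binders/Real34KTypeWedge.lean`, md5 7edd189a, 227 lines);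
landed by the gen-13 packager (p-g13) in gate run 37 as `HodgeCM/Model/Binders/Real34KTypeWedge.lean` (verbatim).
-/
/-
Origin: DISCHARGE seat `prover-pub-hodgecm-mc-discharge-1-g16-0` (unit pub-hodgecm-mc-discharge-1-g16, gen 16 of mc-discharge-1), ticket **D-6**
(BINDER-OWNERS row 15 `real34`, sub-item (K34) `gen_mem`), 2026-08-19.  NEW additive PKG leaf `HodgeCM/Model/Binders/Real34KTypeWedge.lean`:
the ABSTRACT K-type heart of the (K34) hypothesis `hdec` of `Model/Binders/Real34GenMem.lean` (same ticket) — a `det ρ`-type vector in the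
image of a `K`-equivariant BILINEAR pairing of two `𝔭₊`-frames is a multiple of the wedge tensor.  Imports the PKG file `HodgeCM/PerL34/QautWedge`
(pv02-g2, RUN 22: `Qaut.T`, `Qaut.tr`, `Qaut.avg`, `Qaut.symTensor_eq_zero`, `Qaut.T_avg`, `Qaut.tr_avg`) and nothing else of the package; it is
world-independent (no `Level`, no pin).  KERNEL ONLY: 0 records, 0 `def … : Prop`, 0 proof holes, nothing cited, MODEL-N ±0, E text untouched.
Expected `#print axioms`: {propext, Classical.choice, Quot.sound}.
-/
import Summits.HodgeConjecture.HodgeCM.PerL34.QautWedge_2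

/-!
# The wedge law for `det`-type vectors of a bilinear pairing of two `𝔭₊`-frames

PerL v5 Lemma 3.5, (34) half, tex ll. 367–372: in `𝒮(V ⊗ W₃) ⊗ 𝒮(V ⊗ W₄)` a `K_{ι₁}`-isotypic vector of the type `κ ∝ ∧²𝔭₊` built from two
`𝔭₊`-type frames `(φ₂⁰, φ₂¹)`, `(φ₃⁰, φ₃¹)` is a multiple of the WEDGE TENSOR `φ₂⁰ ⊗ φ₃¹ − φ₂¹ ⊗ φ₃⁰` («`∧²` of a two-dimensional representation
is `det`; `Sym²` contains no `det`»).  `PerL34/QautWedge` proved this for PRODUCTS `u(x) v(y)` in a commutative Banach algebra through the Haar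
averaging projection `pr`.  Here the same finite-dimensional heart (`Qaut.symTensor_eq_zero` + the averaged `2`-tensor `Qaut.avg`) is run for an
ARBITRARY bilinear pairing `τ : S₂ →ₗ S₃ →ₗ S_W` into a bare `ℂ`-module `S_W` (no topology on `S_W` — the Schwartz–Bruhat space of the W-block is
not normed): the Haar integral is taken in the coefficient space `ℂ² ⊗ ℂ²` only, and transported through linear functionals of `S_W`
(`Module.forall_dual_apply_eq_zero_iff`).

* `biS τ e f w := Σ_{a,b} w a b • τ (e a) (f b)` — the pairing of the two frames along a coefficient tensor;
* `avg_eq_zero_of_tr_eq` — the averaged tensor of a symmetric tensor vanishes (given a diagonal `diag(s,t)`, `s ≠ t`, and an anti-diagonal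
  matrix in the image of `ρ`: a weight basis of `𝔭₊` and a Weyl representative);
* **`biS_eq_smul_wedge_of_detType`** — MAIN: if `K` acts on the frame span through `ρ ⊗ ρ` up to a scalar `c k` (`hS`) and `v = biS τ e f m`
  is of type `c · det ρ` (`hv`), then `v = ((m 0 1 − m 1 0)/2) • (τ (e 0) (f 1) − τ (e 1) (f 0))`.

* `eq_zero_of_weights` — the `U(1)`-weight count (PerL ll. 368–370; `QautCore.weights_ne_det`-shaped): a vector on which a central element acts
  both by `c ξ^{n₂} ξ^{n₃}` and by `c ξ²`, `ξ ≠ 0` of infinite order, `nⱼ ≥ 1`, `(n₂, n₃) ≠ (1, 1)`, is zero.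

This is the representation-theoretic content of `Real34GenMem`'s `hdec`: pairs of `K`-types other than (`𝔭₊`, `𝔭₊`) are killed by § 4, the pair
(`𝔭₊`, `𝔭₊`) yields wedge tensors by § 3.  Nothing here is a claim of the manuscripts under
adjudication.
-/

set_option autoImplicit false

noncomputable section

open MeasureTheory Matrix
open HodgeCM.PerL34.Qaut

namespace HodgeCM

namespace Model

namespace KTypeWedge

/-! ## 1. The frame pairing along a coefficient tensor -/

section Pairing

variable {S₂ S₃ SW : Type*} [AddCommGroup S₂] [Module ℂ S₂] [AddCommGroup S₃] [Module ℂ S₃] [AddCommGroup SW] [Module ℂ SW]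

/-- `biS τ e f w := Σ_{a,b} w a b • τ (e a) (f b)` — the bilinear pairing of the frames `e`, `f` along the coefficient `2`-tensor `w`. -/
def biS (τ : S₂ →ₗ[ℂ] S₃ →ₗ[ℂ] SW) (e : Fin 2 → S₂) (f : Fin 2 → S₃) : (Fin 2 → Fin 2 → ℂ) →ₗ[ℂ] SW where
  toFun w := ∑ a, ∑ b, w a b • τ (e a) (f b)
  map_add' w w' := by simp only [Pi.add_apply, add_smul, Finset.sum_add_distrib]
  map_smul' r w := by simp only [Pi.smul_apply, smul_eq_mul, RingHom.id_apply, Finset.smul_sum, smul_smul]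

variable (τ : S₂ →ₗ[ℂ] S₃ →ₗ[ℂ] SW) (e : Fin 2 → S₂) (f : Fin 2 → S₃)

/-- (Ported verbatim from the HodgeCMPerL package; no docstring in the source.) -/
theorem biS_apply (w : Fin 2 → Fin 2 → ℂ) : biS τ e f w = ∑ a, ∑ b, w a b • τ (e a) (f b) := rfl

/-- The antisymmetric part of a coefficient tensor pairs to a multiple of the wedge tensor. -/
theorem biS_sub_tr (m : Fin 2 → Fin 2 → ℂ) :
    biS τ e f (m - tr m) = (m 0 1 - m 1 0) • (τ (e 0) (f 1) - τ (e 1) (f 0)) := by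
  simp only [biS_apply, Fin.sum_univ_two, Pi.sub_apply, tr_apply, sub_self, zero_smul, zero_add, add_zero, smul_sub]
  rw [show m 1 0 - m 0 1 = -(m 0 1 - m 1 0) by ring, neg_smul]
  abel

end Pairing

/-! ## 2. The averaged tensor of a symmetric tensor vanishes -/

section Average

variable {K : Type*} [Group K] [TopologicalSpace K] [IsTopologicalGroup K] [MeasurableSpace K] [BorelSpace K] [CompactSpace K]
variable (μ : Measure K) [IsProbabilityMeasure μ] [μ.IsMulLeftInvariant]
variable {ρ : K →* Matrix (Fin 2) (Fin 2) ℂ}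

/-- **`Sym²` has no `det` component**: the `det⁻¹`-twisted Haar average `Qaut.avg` of a SYMMETRIC coefficient tensor is zero, as soon as the
image of `ρ` contains a diagonal matrix with distinct entries and an anti-diagonal matrix (PKG `Qaut.symTensor_eq_zero`, `T_avg`, `tr_avg`). -/
theorem avg_eq_zero_of_tr_eq (hρc : Continuous fun k => ρ k) (hρ : ∀ k, IsUnit (ρ k).det)
    (h₁ : ∃ k s t, s ≠ t ∧ ρ k = !![s, 0; 0, t]) (h₂ : ∃ k a b, ρ k = !![0, a; b, 0])
    (w : Fin 2 → Fin 2 → ℂ) (hw : tr w = w) : avg μ ρ w = 0 := by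
  obtain ⟨k₁, s, t, hst, hk₁⟩ := h₁
  obtain ⟨k₂, a, b, hk₂⟩ := h₂
  have hd₁ : (!![s, 0; 0, t]).det ≠ 0 := by rw [← hk₁]; exact det_ne_zero hρ k₁
  have hd₂ : (!![0, a; b, 0]).det ≠ 0 := by rw [← hk₂]; exact det_ne_zero hρ k₂
  have hT₁ : T !![s, 0; 0, t] (avg μ ρ w) = (!![s, 0; 0, t]).det • avg μ ρ w := by
    rw [← hk₁]; exact T_avg hρc hρ k₁ w
  have hT₂ : T !![0, a; b, 0] (avg μ ρ w) = (!![0, a; b, 0]).det • avg μ ρ w := by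
    rw [← hk₂]; exact T_avg hρc hρ k₂ w
  refine symTensor_eq_zero _ ?_ hst hd₁ hT₁ hd₂ hT₂
  rw [tr_avg hρc hρ, hw]

end Average

/-! ## 3. The wedge law -/

section Wedge

variable {K : Type*} [Group K] [TopologicalSpace K] [IsTopologicalGroup K] [MeasurableSpace K] [BorelSpace K] [CompactSpace K]
variable {ρ : K →* Matrix (Fin 2) (Fin 2) ℂ}
variable {S₂ S₃ SW : Type*} [AddCommGroup S₂] [Module ℂ S₂] [AddCommGroup S₃] [Module ℂ S₃] [AddCommGroup SW] [Module ℂ SW]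

/-- The antisymmetric coefficient tensors are of type `det`: `T A w = det A • w` when `tr w = -w`. -/
theorem T_eq_det_smul_of_tr_eq_neg (A : Matrix (Fin 2) (Fin 2) ℂ) (w : Fin 2 → Fin 2 → ℂ) (hw : tr w = -w) :
    T A w = A.det • w := by
  have h00 : w 0 0 = 0 := by
    have h := congr_fun (congr_fun hw 0) 0
    simp only [tr_apply, Pi.neg_apply] at h
    linear_combination h / 2
  have h11 : w 1 1 = 0 := by
    have h := congr_fun (congr_fun hw 1) 1
    simp only [tr_apply, Pi.neg_apply] at h
    linear_combination h / 2
  have h10 : w 1 0 = -w 0 1 := by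
    have h := congr_fun (congr_fun hw 1) 0
    simp only [tr_apply, Pi.neg_apply] at h
    linear_combination h
  funext i j
  rw [Matrix.det_fin_two]
  fin_cases i <;> fin_cases j <;>
    simp only [T_apply, Fin.sum_univ_two, Pi.smul_apply, smul_eq_mul, h00, h11, h10, Fin.zero_eta, Fin.mk_one, Fin.isValue] <;> ring

/-- **THE WEDGE LAW.**  Let `K` (compact, with a left-invariant probability measure `μ`) act on the span of the paired frame vectors
`τ (e a) (f b)` through `ρ ⊗ ρ` up to a scalar: `ωW k (biS τ e f w) = c k • biS τ e f (T (ρ k) w)` (`hS`; for frames `ω₂ k (e a) = c₂ k • Σ ρ k a' a • e a'`,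
`ω₃ k (f b) = c₃ k • Σ ρ k b' b • f b'` of a `K`-equivariant `τ` this holds with `c = c₂ c₃`), with `ρ` continuous of unit determinant, containing a
diagonal matrix with distinct entries and an anti-diagonal one in its image, and `c k ≠ 0`.  Then every vector `v = biS τ e f m` of type
`c · det ρ` (`hv`) is the multiple `((m 0 1 − m 1 0)/2) • (τ (e 0) (f 1) − τ (e 1) (f 0))` of the wedge tensor. -/
theorem biS_eq_smul_wedge_of_detType (μ : Measure K) [IsProbabilityMeasure μ] [μ.IsMulLeftInvariant]
    (hρc : Continuous fun k => ρ k) (hρ : ∀ k, IsUnit (ρ k).det)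
    (h₁ : ∃ k s t, s ≠ t ∧ ρ k = !![s, 0; 0, t]) (h₂ : ∃ k a b, ρ k = !![0, a; b, 0])
    (τ : S₂ →ₗ[ℂ] S₃ →ₗ[ℂ] SW) (e : Fin 2 → S₂) (f : Fin 2 → S₃) (ωW : K → SW →ₗ[ℂ] SW) (c : K → ℂ) (hc : ∀ k, c k ≠ 0)
    (hS : ∀ (k : K) (w : Fin 2 → Fin 2 → ℂ), ωW k (biS τ e f w) = c k • biS τ e f (T (ρ k) w))
    (m : Fin 2 → Fin 2 → ℂ) (hv : ∀ k : K, ωW k (biS τ e f m) = (c k * (ρ k).det) • biS τ e f m) :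
    biS τ e f m = ((m 0 1 - m 1 0) / 2) • (τ (e 0) (f 1) - τ (e 1) (f 0)) := by
  -- symmetric / antisymmetric split of the coefficient tensor
  set ms : Fin 2 → Fin 2 → ℂ := (1 / 2 : ℂ) • (m + tr m) with hms
  set ma : Fin 2 → Fin 2 → ℂ := (1 / 2 : ℂ) • (m - tr m) with hma
  have hsplit : m = ma + ms := by
    funext i j
    simp only [hma, hms, Pi.add_apply, Pi.smul_apply, Pi.sub_apply, tr_apply, smul_eq_mul]
    ring
  have hms_sym : tr ms = ms := by
    funext i j
    simp only [hms, Pi.smul_apply, Pi.add_apply, tr_apply, smul_eq_mul]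
    ring
  have hma_anti : tr ma = -ma := by
    funext i j
    simp only [hma, Pi.smul_apply, Pi.sub_apply, Pi.neg_apply, tr_apply, smul_eq_mul]
    ring
  have hSa : biS τ e f ma = ((m 0 1 - m 1 0) / 2) • (τ (e 0) (f 1) - τ (e 1) (f 0)) := by
    rw [hma, map_smul, biS_sub_tr, smul_smul]
    congr 1
    ring
  -- the antisymmetric part is of type `c · det`, hence so is the symmetric part `Y`
  have hYtype : ∀ k : K, ωW k (biS τ e f ms) = (c k * (ρ k).det) • biS τ e f ms := by
    intro k
    have h1 : ωW k (biS τ e f ma) = (c k * (ρ k).det) • biS τ e f ma := by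
      rw [hS, T_eq_det_smul_of_tr_eq_neg _ _ hma_anti, map_smul, smul_smul]
    have h2 := hv k
    rw [hsplit, map_add, map_add, h1, smul_add] at h2
    exact add_left_cancel h2
  -- for every `k`: `biS (det(ρ k)⁻¹ • T (ρ k) ms) = biS ms`
  have hfix : ∀ k : K, biS τ e f (((ρ k).det)⁻¹ • T (ρ k) ms) = biS τ e f ms := by
    intro k
    have h := hYtype k
    rw [hS] at h
    rw [map_smul, ← smul_right_injective SW (hc k) |>.eq_iff]
    show c k • ((ρ k).det)⁻¹ • biS τ e f (T (ρ k) ms) = c k • biS τ e f ms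
    rw [smul_comm (c k) ((ρ k).det)⁻¹, h, smul_smul, mul_left_comm, inv_mul_cancel₀ (det_ne_zero hρ k), mul_one]
  -- the symmetric part pairs to zero: test against every linear functional and average over `K`
  have hY : biS τ e f ms = 0 := by
    refine (Module.forall_dual_apply_eq_zero_iff ℂ (biS τ e f ms)).mp fun ℓ => ?_
    set g : (Fin 2 → Fin 2 → ℂ) →L[ℂ] ℂ := LinearMap.toContinuousLinearMap (ℓ ∘ₗ biS τ e f) with hg
    have hconst : ∀ k : K, g (((ρ k).det)⁻¹ • T (ρ k) ms) = ℓ (biS τ e f ms) := fun k => by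
      rw [hg, LinearMap.coe_toContinuousLinearMap', LinearMap.comp_apply, hfix k]
    have hint : ∫ k, g (((ρ k).det)⁻¹ • T (ρ k) ms) ∂μ = ℓ (biS τ e f ms) := by
      simp_rw [hconst]
      rw [integral_const, probReal_univ, one_smul]
    rw [← hint, ContinuousLinearMap.integral_comp_comm g (integrable_avg hρc hρ ms)]
    change g (avg μ ρ ms) = 0
    rw [avg_eq_zero_of_tr_eq μ hρc hρ h₁ h₂ ms hms_sym, map_zero]
  have hsum : biS τ e f m = biS τ e f ma + biS τ e f ms := by rw [← map_add, ← hsplit]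
  rw [hsum, hY, add_zero, hSa]

end Wedge

/-! ## 4. The `U(1)`-weight count -/

section Weights

variable {SW : Type*} [AddCommGroup SW] [Module ℂ SW]

/-- **The `U(1)`-weight count** (PerL ll. 368–370): if a central element acts on a vector `v` both by `c · ξ^{n₂} ξ^{n₃}` (the product of the
weights of its two factors, `nⱼ ≥ 1`) and by `c · ξ²` (the type `κ`), with `ξ ≠ 0` of infinite order, `c ≠ 0` and `(n₂, n₃) ≠ (1, 1)`, then `v = 0`. -/
theorem eq_zero_of_weights {ξ c : ℂ} (hξ0 : ξ ≠ 0) (hξ : ∀ m : ℕ, 1 ≤ m → ξ ^ m ≠ 1) (hc : c ≠ 0) {n₂ n₃ : ℕ} (h₂ : 1 ≤ n₂) (h₃ : 1 ≤ n₃)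
    (hne : ¬(n₂ = 1 ∧ n₃ = 1)) {A : SW →ₗ[ℂ] SW} {v : SW}
    (hprod : A v = (c * (ξ ^ n₂ * ξ ^ n₃)) • v) (hκ : A v = (c * ξ ^ 2) • v) : v = 0 := by
  have hw : ξ ^ n₂ * ξ ^ n₃ ≠ ξ ^ 2 := by
    rw [← pow_add]
    have h3 : 2 + 1 ≤ n₂ + n₃ := by omega
    obtain ⟨m, hm⟩ := Nat.exists_eq_add_of_le h3
    intro heq
    have hm' : n₂ + n₃ = 2 + (m + 1) := by omega
    rw [hm', pow_add] at heq
    have h2ne : ξ ^ 2 ≠ 0 := pow_ne_zero _ hξ0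
    have hone : ξ ^ (m + 1) = 1 := mul_left_cancel₀ h2ne (heq.trans (mul_one (ξ ^ 2)).symm)
    exact hξ (m + 1) (by omega) hone
  have h : (c * (ξ ^ n₂ * ξ ^ n₃) - c * ξ ^ 2) • v = 0 := by rw [sub_smul, ← hprod, ← hκ, sub_self]
  rcases smul_eq_zero.mp h with h0 | h0
  · exact absurd (mul_left_cancel₀ hc (sub_eq_zero.mp h0)) hw
  · exact h0

end Weights

end KTypeWedge

end Model

end HodgeCM

end
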